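import Summits.QuantumFields.YangMills.Theorems.BalabanUVNodesN15PerCubeGreenAdjointGreen
import Summits.QuantumFields.YangMills.Theorems.BalabanUVNodesN15PerCubeGreenInstance
import Summits.QuantumFields.YangMills.Theorems.BalabanUVNodesN15CurvedLocalSpeciesOfReg335UN
import HarnessLib

/-!
# N15 = NE2, road (c) — PROGRAMME (PC), (PC-A″) NON-VACUITY: THE THIRD ENTRY `G′(U)∇*_U` OF (3.42) AT EVERY PURE GAUGE, NO FURTHER HYPOTHESIS — the class datum per box and the
# smallness letters of n15-c∕286 EXHIBITED for `U_μ(x) = v(x)v(x + e_μ)⁻¹`, `v` ANY unitary site field (dag-n15-c g27, n15-c∕287)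

Cell `pub-ymgap`, seat `pub-ymgap-dag-n15-c` (generation g27; R134 (a), s1; HUMAN RULING D-0062).  `bears_on: R4∕N15 · K3⁸ SpineGivenEndpointR13SepCoPHV (stmt-QuantumFields-27366)`;
filed `--kind proof --supports stmt-QuantumFields-27366 --as helper` — COUNT-NEUTRAL.  One theorem, 0 `def`, 0 `sorry`.  Imports BY NAME n15-c∕286 `…PerCubeGreenAdjointGreen`
(`hasMaj_cGreen_adjGrad_of_reg335Box`), n15-c∕267 `…PerCubeGreenInstance` (`sigma_le_of_small`), dag-n15-w2 `…CurvedLocalSpeciesOfReg335UN` (`uN_reg335Cube_pureGauge`).  Proof =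
n15-c∕277 `hasMaj_cgradGreen_pureGauge`'s arithmetic VERBATIM plus the third letter bound `|ι|Q ≤ r_V` (`ξ = 1`: `Q`'s bound is `P`'s).  Nothing in the tree is modified.

WHAT.  ★★★ `hasMaj_cGreen_adjGrad_pureGauge`: for odd `L ≥ 7`, `a₀ > 0`, colour index `ι` there are `δ > 0`, `w₀`, `B₁ ≥ 0` such that on every doubled torus of the cover (`k ≥ 1`,
`L^m ≥ w₀`), for trace-form coordinates `e` and EVERY unitary site field `v`, the pure gauge `U = v·v(·+e_μ)⁻¹` satisfies, for every `ν`, `mulVecLin (G′(U))∘D*_{U,ν} ≤ B₁e^{−(δ∕16)d}`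
(site → site) and `mulVecLin (G′(U)·(D_U)ᵀ) ≤ (d+1)B₁e^{−(δ∕16)d}` (bond → site) — so n15-c∕286's hypotheses are inhabited at every index by a non-trivial (gauge-curved) field.

HONEST FRAMING ∕ LIMITS.  Non-vacuity witness only (pure gauges are gauge-equivalent to `U ≡ 1`); MODEL carriers; nothing of [B9] asserted ((3.35) p.396, (3.42) p.397 = SHAPES).  NE2⁺
NOT PRINTED, NOT proved; N15 of record untouched; K3⁸ OPEN; counts of record UNMOVED (typed 28∕28 · discharged 8∕27); one finite 𝕋⁴ at fixed ε — NOT infinite volume, NOT OS on ℝ⁴,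
NOT a mass gap, NOT Clay.  Restate-immune (no Theses import).
-/

noncomputable section

open scoped BigOperators Matrix Matrix.Norms.L2Operator

namespace Summit.QuantumFields.YangMills.BalabanUVNodes.N15.Gluing

open Real
open Literature.MathematicalPhysics.QuantumFieldTheory.Balaban1983to89
open Literature.MathematicalPhysics.QuantumFieldTheory.Balaban1983to89.B5Prop11Plancherel (Tor fine unitVec)
open Literature.MathematicalPhysics.QuantumFieldTheory.Balaban1983to89.B11SectG (BlockNorm HasMaj)
open Literature.MathematicalPhysics.QuantumFieldTheory.Balaban1983to89.B6UnitTorusCarrier (unitTorusGeo)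
open Literature.MathematicalPhysics.QuantumFieldTheory.Balaban1983to89.B9Eq335RegularityClasses (Reg335Cube)
open Literature.MathematicalPhysics.QuantumFieldTheory.Balaban1983to89.B9Eq3117Current (gaugeTr)
open Literature.MathematicalPhysics.QuantumFieldTheory.King1986 (aK)
open Literature.MathematicalPhysics.QuantumFieldTheory.King1986.Torus (blockOf)
open Literature.Barriers.QuantumFields (traceForm)
open Summit.QuantumFields.YangMills.BalabanUVNodes.N15.MatrixSpecies (coordMat basisConst basisConst_nonneg liftBlk covD)
open Summit.QuantumFields.YangMills.BalabanUVNodes.N15.TwoGrid (cubeBlocks)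
open Summit.QuantumFields.YangMills.BalabanUVNodes.N15.CurvedSpecies (uN_reg335Cube_pureGauge)
open Summit.QuantumFields.YangMills.BalabanUVNodes.N15.CovLandau (cGreen cgrad)

variable {d : ℕ}

/-! ## The third entry of (3.42) at every pure gauge, no further hypothesis -/

section PureGauge

variable {L : ℕ} [NeZero L]

/-- ★★★ **NON-VACUITY OF n15-c∕286: THE ADJOINT-GRADIENT ROWS OF `G′(U)` AT EVERY PURE GAUGE.**  For odd `L ≥ 7`, `a₀ > 0` and a colour index `ι` there are `δ > 0`, `w₀`, `B₁ ≥ 0` such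
that on every doubled torus of the cover, for trace-form coordinates `e` of `𝔲(m)` and EVERY unitary site field `v`, the pure gauge `U_μ(x) = v(x)v(x + e_μ)⁻¹` gives, for every `ν`,
`mulVecLin (G′(U))∘D*_{U,ν} ≤ B₁·e^{−(δ∕16)|y−y′|_T}` and `mulVecLin (G′(U)·(D_U)ᵀ) ≤ (d+1)B₁·e^{−(δ∕16)|y−y′|_T}` — the class datum per box (`ξ = 1`, `C = min 1 (r_V∕(P₁+P₂+1))`) and the
letters EXHIBITED (n15-c∕277's arithmetic).  MODEL carriers. [cite: Balaban1985BackgroundPropagators, (3.35) p.396, Thm 3.1 (3.42) p.397 (entry `G′(U)∇*_U`: shape)] -/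
theorem hasMaj_cGreen_adjGrad_pureGauge (hL : Odd L ∧ 1 < L) (hL7 : 7 ≤ L) {a₀ : ℝ} (ha₀ : 0 < a₀) (ι : Type) [Fintype ι] [DecidableEq ι] :
    ∃ δ w₀ B₁ : ℝ, 0 < δ ∧ 0 ≤ B₁ ∧
      ∀ (mv kk : ℕ), 1 ≤ kk → w₀ ≤ ((L ^ mv : ℕ) : ℝ) →
      ∀ {mm : Type} [Fintype mm] [DecidableEq mm] [Nonempty mm] (e : Matrix mm mm ℂ ≃L[ℝ] (ι → ℝ)), (∀ A B : Matrix mm mm ℂ, traceForm A B = e A ⬝ᵥ e B) →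
      ∀ (v : ScX d L mv kk hL → (Matrix mm mm ℂ)ˣ), (∀ x, (v x : Matrix mm mm ℂ) ∈ Matrix.unitaryGroup mm ℂ) →
        (∀ ν : Fin (d + 1), HasMaj (ScNorm d L mv kk hL ι) (ScNorm d L mv kk hL ι)
            (Matrix.mulVecLin (cGreen (cvM d L mv kk hL) (L ^ kk) (cvT e (fun μ x => (gaugeTr (scShift d L mv kk hL) v (fun (_ : Fin (d + 1)) (_ : ScX d L mv kk hL) => (1 : (Matrix mm mm ℂ)ˣ)) μ x : Matrix mm mm ℂ))) (aK a₀ (L : ℝ) kk * (((L ^ kk : ℕ) : ℝ)) ^ (d + 1))) ∘ₗ covD ((((L ^ kk : ℕ) : ℝ))⁻¹) (fun y => ((cvT e (fun μ x => (gaugeTr (scShift d L mv kk hL) v (fun (_ : Fin (d + 1)) (_ : ScX d L mv kk hL) => (1 : (Matrix mm mm ℂ)ˣ)) μ x : Matrix mm mm ℂ))) ν ((scShift d L mv kk hL ν).symm y))ᵀ) ⇑(scShift d L mv kk hL ν).symm)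
            (fun y y' => B₁ * Real.exp (-(δ / 16 * (unitTorusGeo L kk (cvM d L mv kk hL)).dist y y')))) ∧
        HasMaj (BlockNorm.ofBlocks (unitTorusGeo L kk (cvM d L mv kk hL)) (liftBlk (fun b : ScX d L mv kk hL × Fin (d + 1) => blockOf (L ^ kk) (cvM d L mv kk hL) b.1) ι)) (ScNorm d L mv kk hL ι)
            (Matrix.mulVecLin (cGreen (cvM d L mv kk hL) (L ^ kk) (cvT e (fun μ x => (gaugeTr (scShift d L mv kk hL) v (fun (_ : Fin (d + 1)) (_ : ScX d L mv kk hL) => (1 : (Matrix mm mm ℂ)ˣ)) μ x : Matrix mm mm ℂ))) (aK a₀ (L : ℝ) kk * (((L ^ kk : ℕ) : ℝ)) ^ (d + 1)) * (cgrad (cvM d L mv kk hL) (L ^ kk) (cvT e (fun μ x => (gaugeTr (scShift d L mv kk hL) v (fun (_ : Fin (d + 1)) (_ : ScX d L mv kk hL) => (1 : (Matrix mm mm ℂ)ˣ)) μ x : Matrix mm mm ℂ))))ᵀ))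
            (fun y y' => ((d : ℝ) + 1) * B₁ * Real.exp (-(δ / 16 * (unitTorusGeo L kk (cvM d L mv kk hL)).dist y y'))) := by
  obtain ⟨δ, w₀, R₀, B, hδ, hR₀, hB, H⟩ := hasMaj_cGreen_adjGrad_of_reg335Box (d := d) hL hL7 ha₀ ι
  -- the smallness letter `r_V` (scale independent)
  set K : ℝ := (1 + Fintype.card (Fin (d + 1) ⊕ Fin (d + 1))) + a₀ * (Fintype.card ι * ((Fintype.card ι + 2) * (2 * ((d : ℝ) + 1)))) + 1 with hK
  have hK0 : 0 < K := by positivity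
  set rV : ℝ := min (1 / (2 * ((d : ℝ) + 1))) (R₀ / K) with hrV
  have hrV0 : 0 < rV := lt_min (by positivity) (by positivity)
  refine ⟨δ, w₀, B * (1 + rV), hδ, by positivity, fun mv kk hk hw₀ => ?_⟩
  intro mm _ _ _ e he v hv
  have hnr : (0 : ℝ) < ((L ^ kk : ℕ) : ℝ) := by exact_mod_cast pow_pos (Nat.pos_of_ne_zero (NeZero.ne L)) kk
  have hn1 : (1 : ℝ) ≤ ((L ^ kk : ℕ) : ℝ) := by exact_mod_cast Nat.one_le_pow _ _ (Nat.pos_of_ne_zero (NeZero.ne L))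
  have hη1 : ((((L ^ kk : ℕ) : ℝ))⁻¹) ≤ 1 := inv_le_one_of_one_le₀ hn1
  have hη0 : 0 ≤ ((((L ^ kk : ℕ) : ℝ))⁻¹) := by positivity
  have hrV1 : 2 * ((d : ℝ) + 1) * rV ≤ 1 := by
    have h := min_le_left (1 / (2 * ((d : ℝ) + 1))) (R₀ / K)
    rw [← hrV] at h
    have hd : (0 : ℝ) < 2 * ((d : ℝ) + 1) := by positivity
    calc 2 * ((d : ℝ) + 1) * rV ≤ 2 * ((d : ℝ) + 1) * (1 / (2 * ((d : ℝ) + 1))) := mul_le_mul_of_nonneg_left h hd.le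
      _ = 1 := by field_simp
  have hrVK : rV * K ≤ R₀ := by
    have h := min_le_right (1 / (2 * ((d : ℝ) + 1))) (R₀ / K)
    rw [← hrV] at h
    calc rV * K ≤ R₀ / K * K := mul_le_mul_of_nonneg_right h hK0.le
      _ = R₀ := by field_simp
  obtain ⟨hσ0, hσle, hσ1⟩ := sigma_le_of_small d (L ^ kk) (pow_pos (Nat.pos_of_ne_zero (NeZero.ne L)) kk) hrV0.le hrV1
  -- the class constant `C`
  set g : ℝ := @basisConst ι _ (Matrix mm mm ℂ) Matrix.frobeniusNormedAddCommGroup Matrix.frobeniusNormedSpace e * (2 * Real.sqrt (Fintype.card mm)) with hg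
  have hg0 : 0 ≤ g := by have := @basisConst_nonneg ι _ (Matrix mm mm ℂ) Matrix.frobeniusNormedAddCommGroup Matrix.frobeniusNormedSpace e; positivity
  set Q : ℝ := g * (Real.sqrt (Fintype.card mm) * 3) with hQ
  have hQ0 : 0 ≤ Q := by positivity
  set P₁ : ℝ := Fintype.card ι * Q with hP₁
  set P₂ : ℝ := Fintype.card ι * (Fintype.card (Fin (d + 1)) * (Fintype.card ι * Q ^ 2 + Q)) with hP₂
  have hP₁0 : 0 ≤ P₁ := by positivity
  have hP₂0 : 0 ≤ P₂ := by positivity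
  set C : ℝ := min 1 (rV / (P₁ + P₂ + 1)) with hC
  have hC0 : 0 < C := lt_min one_pos (by positivity)
  have hC1 : C ≤ 1 := min_le_left _ _
  have hCr : C * (P₁ + P₂ + 1) ≤ rV := by
    have h := min_le_right 1 (rV / (P₁ + P₂ + 1))
    rw [← hC] at h
    calc C * (P₁ + P₂ + 1) ≤ rV / (P₁ + P₂ + 1) * (P₁ + P₂ + 1) := mul_le_mul_of_nonneg_right h (by positivity)
      _ = rV := by field_simp
  have hE : Real.exp (((((L ^ kk : ℕ) : ℝ))⁻¹) * (C / 1)) ≤ 3 := by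
    rw [div_one]
    have h1 : ((((L ^ kk : ℕ) : ℝ))⁻¹) * C ≤ 1 := mul_le_one₀ hη1 hC0.le hC1
    calc Real.exp (((((L ^ kk : ℕ) : ℝ))⁻¹) * C) ≤ Real.exp 1 := Real.exp_le_exp.mpr h1
      _ ≤ 3 := by have := Real.exp_one_lt_d9; linarith
  -- the one-bond letter `Y = g√m·C·e^{ηC} ≤ Q·C`
  have hY : g * (Real.sqrt (Fintype.card mm) * ((C / 1) * Real.exp (((((L ^ kk : ℕ) : ℝ))⁻¹) * (C / 1)))) ≤ Q * C := by
    have : (C / 1) * Real.exp (((((L ^ kk : ℕ) : ℝ))⁻¹) * (C / 1)) ≤ 3 * C := by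
      rw [mul_comm]; rw [div_one] at hE ⊢; exact mul_le_mul_of_nonneg_right hE hC0.le
    calc g * (Real.sqrt (Fintype.card mm) * ((C / 1) * Real.exp (((((L ^ kk : ℕ) : ℝ))⁻¹) * (C / 1)))) ≤ g * (Real.sqrt (Fintype.card mm) * (3 * C)) := by gcongr
      _ = Q * C := by rw [hQ]; ring
  have hY0 : 0 ≤ g * (Real.sqrt (Fintype.card mm) * ((C / 1) * Real.exp (((((L ^ kk : ℕ) : ℝ))⁻¹) * (C / 1)))) := by positivity
  have hY2 : g * (Real.sqrt (Fintype.card mm) * ((C / 1 ^ 2) * Real.exp (((((L ^ kk : ℕ) : ℝ))⁻¹) * (C / 1)))) ≤ Q * C := by rw [one_pow]; exact hY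
  -- the two explicit letter bounds
  have hrA : Fintype.card ι * (g * (Real.sqrt (Fintype.card mm) * ((C / 1) * Real.exp (((((L ^ kk : ℕ) : ℝ))⁻¹) * (C / 1))))) ≤ rV := by
    calc Fintype.card ι * (g * (Real.sqrt (Fintype.card mm) * ((C / 1) * Real.exp (((((L ^ kk : ℕ) : ℝ))⁻¹) * (C / 1))))) ≤ Fintype.card ι * (Q * C) := by gcongr
      _ = P₁ * C := by rw [hP₁]; ring
      _ ≤ rV := by have := mul_nonneg hC0.le hP₂0; linarith
  have hrC : Fintype.card ι * (Fintype.card (Fin (d + 1)) * (Fintype.card ι * (g * (Real.sqrt (Fintype.card mm) * ((C / 1) * Real.exp (((((L ^ kk : ℕ) : ℝ))⁻¹) * (C / 1))))) ^ 2 +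
      g * (Real.sqrt (Fintype.card mm) * ((C / 1 ^ 2) * Real.exp (((((L ^ kk : ℕ) : ℝ))⁻¹) * (C / 1)))))) ≤ rV := by
    have h1 : (g * (Real.sqrt (Fintype.card mm) * ((C / 1) * Real.exp (((((L ^ kk : ℕ) : ℝ))⁻¹) * (C / 1))))) ^ 2 ≤ Q ^ 2 * C := by
      calc (g * (Real.sqrt (Fintype.card mm) * ((C / 1) * Real.exp (((((L ^ kk : ℕ) : ℝ))⁻¹) * (C / 1))))) ^ 2 ≤ (Q * C) ^ 2 := pow_le_pow_left₀ hY0 hY 2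
        _ = Q ^ 2 * (C * C) := by ring
        _ ≤ Q ^ 2 * C := mul_le_mul_of_nonneg_left (mul_le_of_le_one_left hC0.le hC1) (by positivity)
    calc Fintype.card ι * (Fintype.card (Fin (d + 1)) * (Fintype.card ι * (g * (Real.sqrt (Fintype.card mm) * ((C / 1) * Real.exp (((((L ^ kk : ℕ) : ℝ))⁻¹) * (C / 1))))) ^ 2 +
          g * (Real.sqrt (Fintype.card mm) * ((C / 1 ^ 2) * Real.exp (((((L ^ kk : ℕ) : ℝ))⁻¹) * (C / 1))))))
        ≤ Fintype.card ι * (Fintype.card (Fin (d + 1)) * (Fintype.card ι * (Q ^ 2 * C) + Q * C)) := by gcongr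
      _ = P₂ * C := by rw [hP₂]; ring
      _ ≤ rV := by have := mul_nonneg hC0.le hP₁0; linarith
  -- the smallness inequality
  have hRle : rV * (1 + Fintype.card (Fin (d + 1) ⊕ Fin (d + 1))) + a₀ * (Fintype.card ι * (Fintype.card ι * ((1 + rV * ((((L ^ kk : ℕ) : ℝ))⁻¹)) ^ ((d + 1) * L ^ kk) - 1) ^ 2 +
      2 * ((1 + rV * ((((L ^ kk : ℕ) : ℝ))⁻¹)) ^ ((d + 1) * L ^ kk) - 1))) ≤ R₀ := by
    set σ : ℝ := (1 + rV * ((((L ^ kk : ℕ) : ℝ))⁻¹)) ^ ((d + 1) * L ^ kk) - 1 with hσ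
    have hσ2 : σ ^ 2 ≤ σ := by
      calc σ ^ 2 = σ * σ := sq σ
        _ ≤ 1 * σ := mul_le_mul_of_nonneg_right hσ1 hσ0
        _ = σ := one_mul σ
    have h1 : Fintype.card ι * σ ^ 2 + 2 * σ ≤ (Fintype.card ι + 2) * (2 * (((d : ℝ) + 1) * rV)) := by
      have hc : (0 : ℝ) ≤ Fintype.card ι := by positivity
      calc Fintype.card ι * σ ^ 2 + 2 * σ ≤ Fintype.card ι * σ + 2 * σ := by gcongr
        _ = (Fintype.card ι + 2) * σ := by ring
        _ ≤ (Fintype.card ι + 2) * (2 * (((d : ℝ) + 1) * rV)) := mul_le_mul_of_nonneg_left hσle (by positivity)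
    calc rV * (1 + Fintype.card (Fin (d + 1) ⊕ Fin (d + 1))) + a₀ * (Fintype.card ι * (Fintype.card ι * σ ^ 2 + 2 * σ))
        ≤ rV * (1 + Fintype.card (Fin (d + 1) ⊕ Fin (d + 1))) + a₀ * (Fintype.card ι * ((Fintype.card ι + 2) * (2 * (((d : ℝ) + 1) * rV)))) := by gcongr
      _ = rV * ((1 + Fintype.card (Fin (d + 1) ⊕ Fin (d + 1))) + a₀ * (Fintype.card ι * ((Fintype.card ι + 2) * (2 * ((d : ℝ) + 1))))) := by ring
      _ ≤ rV * K := mul_le_mul_of_nonneg_left (by rw [hK]; linarith) hrV0.le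
      _ ≤ R₀ := hrVK
  -- the class on every box and the unitarity of the pure gauge
  have h335 := fun k : Fin (d + 1) → ZMod (2 * L) => (uN_reg335Cube_pureGauge (τ := scShift d L mv kk hL) (η := ((((L ^ kk : ℕ) : ℝ))⁻¹)) v hv
    {x : ScX d L mv kk hL | blockOf (L ^ kk) (cvM d L mv kk hL) x ∈ cubeBlocks (cvM d L mv kk hL) (coverCorner (cvM d L mv kk hL) (L ^ mv) L (2 * L ^ mv + 2) k) (6 * L ^ mv + 5)} one_pos hC0).1
  have hU := (uN_reg335Cube_pureGauge (τ := scShift d L mv kk hL) (η := ((((L ^ kk : ℕ) : ℝ))⁻¹)) v hv (Set.univ : Set (ScX d L mv kk hL)) one_pos hC0).2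
  have hrQ : Fintype.card ι * (g * (Real.sqrt (Fintype.card mm) * ((C / 1 ^ 2) * Real.exp (((((L ^ kk : ℕ) : ℝ))⁻¹) * (C / 1))))) ≤ rV := by
    calc Fintype.card ι * (g * (Real.sqrt (Fintype.card mm) * ((C / 1 ^ 2) * Real.exp (((((L ^ kk : ℕ) : ℝ))⁻¹) * (C / 1))))) ≤ Fintype.card ι * (Q * C) := by gcongr
      _ = P₁ * C := by rw [hP₁]; ring
      _ ≤ rV := by have := mul_nonneg hC0.le hP₂0; linarith
  rw [hg] at hrA hrC hrQ
  exact H mv kk hk hw₀ e he (gaugeTr (scShift d L mv kk hL) v (fun (_ : Fin (d + 1)) (_ : ScX d L mv kk hL) => (1 : (Matrix mm mm ℂ)ˣ))) hU 1 C one_pos hC0.le h335 rV hrV0.le hrA hrC hrQ hRle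

end PureGauge

end Summit.QuantumFields.YangMills.BalabanUVNodes.N15.Gluing

end
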